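import Summits.QuantumFields.BalabanUV.T4Continuum.Support.NE9Lemma1RemainderPiece

/-!
# NE9Lemma1CurveRemainder — LOCATED CORRECTION O-ne9p1g25-1 of the displayed species' typing, part 1 of 3: the fifth-order
# remainder of [I] (3.34) is taken along the ANALYTIC CURVE σ ↦ U_j(□₀, exp iσB)|_X of Lemma 4 (3.53), NOT along a ray of the
# configuration chart — the Taylor remainder of an analytic old term ALONG A CURVE and its (1.23)-functional, bounded at FORM
# level ((I.3.54) = Cauchy in σ ⊕ [II] (1.24)); the ray form of part 5 (`dirRem`, `remPiece`) is the special case γ(σ) = σ•A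
# (cell `pub-balaban`, T4-DAG §2 node U3 / §6 NE9; lineage t4-ne9-p1 = row NE9 OWNER, generation 25)

v1.0.1 DOCFIX (docstrings only, declarations byte-unchanged): `curPiece`'s gloss of the slice curve is σ′ ↦ U_j(□₀, exp iσ′B)|_X,
centred at the expansion point σ′ = 0 and read at σ′ = 1 (v1 wrote «exp i(1 + σ′)B»).

HONEST FRAMING (T4-DAG PAGE 1).  Rung (B)+1 of the FINITE-VOLUME T⁴ programme — NOT infinite volume, NOT a mass gap, NOT the
Clay problem.  NE9 (`T4OutputRate.NE9` ∧ `FadingMemory`) is a cell NEW ESTIMATE, NOT PRINTED, NOT discharged here; spine 0/9.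
HONEST DEPENDENCY (cell line, verbatim): continuum YM on T⁴ ⇐ BetaPertH ∧ nine spine estimates (0/9 proved); BetaPertH ⇐ (D1)
∧ (D4) ∧ CAP+tail; G-an2-4 gates asym, D1 and NE2/3/4.  `FlowStep.BetaPertH`, (B), (B^μ) do not occur.  [I] = [Balaban1987RG1]
(CMP **109**), [II] = [Balaban1988RG2Cluster] (CMP **116**) are quoted for TYPES only (ABSOLUTE RULE: nothing printed in the
audited series is asserted).

WHAT WAS WRONG (located by the owner lineage, gen 25, against the renders of [I] pp. 275–280).  Parts 2–5 of the species
programme (`NE9Lemma1RemainderPiece.dirRem`/`remPiece`, `NE9Lemma1RemainderSpecies.RemData`/`toC`) evaluate the old term `H`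
along RAYS `τ ↦ τ•A(t, s, σ)` issuing from the centre of its analyticity ball in a complex normed configuration chart `E`.
[I] (3.34) p. 277 expands `τ ↦ 𝐄^{(j)}(X, U_j(□₀, exp iτB))`, and (3.54) p. 280 bounds its last term by the Cauchy formula in
the complex variable σ of *"𝐄^{(j)}(X, U_j(□₀, exp i(τB + σB)))"* on `|σ| = r`, using Lemma 4 (3.53) p. 280: *"(U_j(□₀,
exp i(τB + B′)), J_j(□₀, exp i(τB + B′)))|_X ∈ U^c_j(X, α₀, α₁)"* for `|B′| < α₃`, *"The functions in (3.53) are analytic on the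
above spaces."*  The background map `B ↦ U_j(□₀, exp iB)` is NOT linear for a non-abelian group: (3.37) p. 277 *"U_j(□₀,
exp iτQ(L⁻¹η𝐇_{k+1})) = (exp iξ𝐇_j(□₀, τQ(L⁻¹η𝐇_{k+1})))^{u_j}"* with 𝐇_j the scale-j minimizer of the (non-quadratic)
variational problem and u_j a configuration-dependent gauge transformation, and (3.30) p. 276 *"A = (iη)⁻¹ log exp iη𝐀
exp iL⁻¹η𝐇_{k+1}(□₀, i⁻¹ log V), B = Q(ηA)"* (group law).  So the image of the σ-disc is an analytic CURVE through the expansion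
point `U_j(□₀, 1)` inside `U^c_j(X)`, a ray only when `G` is abelian: the ray datum `RemData.dir` cannot be instantiated on
Bałaban's (1.23)-pieces for `G = SU(2)` (O1 for the species AS TYPED in skeleton v1.3.5 is unsatisfiable), although every
landed implication is correct.  Same class of finding as O-ne9p1g22-1/g23-1/g24-1: nothing false, an uninstantiable datum shape.

THE REPAIR, part 1 (this file; kernel, 0 sorry).
* §1 `curRem H n γ := taylorRem (H ∘ γ) n 1` — the order-n remainder of the old term ALONG A CURVE `γ : ℂ → E`;
  **`norm_curRem_le`**: `H` analytic on the ball of radius `R` and bounded by `M` there, `γ` analytic on the disc `|σ| < ϱ` and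
  mapping it into that ball, `ϱ > 1` ⟹ `‖curRem H n γ‖ ≤ 2ⁿ·M·ϱ⁻ⁿ` (iterated Schwarz on the composite slice — (3.54)'s Cauchy
  estimate in σ with the unprinted absolute 2ⁿ; print: `ϱ = α₃/|B|`, `ϱ⁻¹ < (α₁/α₃)L^jη`).  The ray is the special case
  `curRem H n (σ ↦ σ•A) = dirRem H n A` (`curRem_ray`, `rfl`; `mapsTo_ray`: ϱ = R/a recovers `norm_dirRem_le`).
* §2 `curPiece` — the (1.23) contour functional of [II] p. 7 applied to `curRem` (`B13Sect1Arith.cauchyOp`, t_□-circle);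
  **`norm_curPiece_le`** = `B13Sect1Arith.bound_124` with its remainder hypothesis discharged by `norm_curRem_le`;
  `curPiece_ray : curPiece … (σ′ ↦ σ′•A t s σ) = remPiece … A` (`rfl`); `curPiece_zero`.
Parts 2–3 (`NE9Lemma1CurveSpecies`, `NE9Lemma1CurveSpeciesEnd`): the datum `CurData`, the per-piece bound `PieceBoundOnG` and leaf
S5 PROVED on the analytic class for curve data, the ray species as the literal special case, and the END face.
DISGUISE TEST: one term, one curve family, one history; a size bound, not NE9.

References (TYPES only): [Balaban1987RG1] T. Bałaban, CMP **109** (1987) 249–301, (3.28)–(3.30) p. 276, (3.33)–(3.37) p. 277,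
Lemma 4 (3.53)–(3.54) p. 280; [Balaban1988RG2Cluster] T. Bałaban, CMP **116** (1988) 1–22, (1.1) p. 3, (1.22)–(1.24) p. 7.
Summits-side NEW work (LEAN PLACEMENT RULE); imports part 5 `NE9Lemma1RemainderPiece` (hence `B13Sect1Arith`,
`B13ExpansionOrder`) BY NAME; modifies nothing; 0 sorry.  Value = a located correction of the species' datum shape with the
remainder bound re-proved for the corrected shape, NOT summit progress.
-/

noncomputable section

namespace Summit.QuantumFields.BalabanUV.T4Continuum.NE9Lemma1CurveRemainder

open scoped BigOperators
open Metric Set Complex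
open Literature.MathematicalPhysics.QuantumFieldTheory.Balaban1983to89
open Summit.QuantumFields.BalabanUV.T4Continuum.NE9Lemma1RemainderPiece

/-! ## §1 The Taylor remainder of an analytic old term ALONG AN ANALYTIC CURVE — the shape of [I] (3.53)–(3.54) -/

section Curve

variable {E : Type*} {F : Type*} [NormedAddCommGroup F] [NormedSpace ℂ F]

/-- The order-`n` Taylor remainder at `σ = 0`, evaluated at `σ = 1`, of the old term `H` ALONG THE CURVE `γ : ℂ → E`:
`R_n[σ ↦ H(γ σ)](1)` — for n = 5 and γ σ = (chart of) `U_j(□₀, exp iσB)|_X` the reading of *"the last term in the expansion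
(3.34)"* of [I] p. 277, whose bound (3.54) p. 280 is the Cauchy formula in σ for *"𝐄^{(j)}(X, U_j(□₀, exp i(τB + σB)))"*.
[cite: Balaban1987RG1, (3.34) p.277] -/
def curRem (H : E → F) (n : ℕ) (γ : ℂ → E) : F := taylorRem (fun σ : ℂ => H (γ σ)) n 1

/-- The curve remainder of the zero term vanishes. [folklore] -/
theorem curRem_zero (n : ℕ) (γ : ℂ → E) : curRem (0 : E → F) n γ = 0 := by
  unfold curRem taylorRem taylorHead
  have h0 : (fun σ : ℂ => (0 : E → F) (γ σ)) = 0 := by funext σ; rfl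
  rw [h0]
  simp [Literature.MathematicalPhysics.QuantumFieldTheory.Balaban1983to89.B13ExpansionOrder.tail_zero_fun]

variable [NormedAddCommGroup E] [NormedSpace ℂ E]

/-- The ray is the special case: `curRem H n (σ ↦ σ•A) = dirRem H n A` (definitional). [folklore] -/
theorem curRem_ray (H : E → F) (n : ℕ) (A : E) : curRem H n (fun σ : ℂ => σ • A) = dirRem H n A := rfl

/-- The composite slice `σ ↦ H(γ σ)` is analytic on the disc `|σ| < ϱ` when `γ` is analytic there and maps the disc into the
analyticity ball of `H`. [folklore] -/
theorem differentiableOn_curSlice {H : E → F} {R ϱ : ℝ} (hH : DifferentiableOn ℂ H (ball 0 R)) {γ : ℂ → E}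
    (hγ : DifferentiableOn ℂ γ (ball 0 ϱ)) (hmaps : MapsTo γ (ball 0 ϱ) (ball 0 R)) :
    DifferentiableOn ℂ (fun σ : ℂ => H (γ σ)) (ball 0 ϱ) :=
  hH.comp hγ hmaps

variable [CompleteSpace F]

/-- **THE REMAINDER BOUND ALONG A CURVE** — the shape of [I] (3.54) p. 280 (*"≦ sup_{r∈[0,1]} |∫_{|σ|=r} dσ σ⁻⁶ 𝐄^{(j)}(X,
U_j(□₀, exp i(τB + σB)))| ≦ E₀α₃⁻⁵|B|⁵exp(−κd_j(X))"*): for `H` analytic on the ball `‖z‖ < R` with `‖H z‖ ≤ M` there, and a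
curve `γ` analytic on the disc `|σ| < ϱ` mapping it into that ball (Lemma 4 (3.53): `ϱ = α₃/|B|`), with `ϱ > 1`,
`‖curRem H n γ‖ ≤ 2ⁿ·M·ϱ⁻ⁿ` (iterated Schwarz on the composite slice; print's constant is 1·α₃⁻ⁿ|B|ⁿ by the exact Cauchy
formula for the n-th coefficient, here 2ⁿ from the divided-slope route of part 5 — an unprinted absolute factor).
[cite: Balaban1987RG1, (3.54) p.280] -/
theorem norm_curRem_le {H : E → F} {R M ϱ : ℝ} {n : ℕ} (hH : DifferentiableOn ℂ H (ball 0 R))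
    (hM : ∀ z ∈ ball (0 : E) R, ‖H z‖ ≤ M) {γ : ℂ → E} (hγ : DifferentiableOn ℂ γ (ball 0 ϱ))
    (hmaps : MapsTo γ (ball 0 ϱ) (ball 0 R)) (hϱ : 1 < ϱ) :
    ‖curRem H n γ‖ ≤ 2 ^ n * M * ϱ⁻¹ ^ n := by
  have h1 : (1 : ℂ) ∈ ball (0 : ℂ) ϱ := by rw [mem_ball_zero_iff, norm_one]; exact hϱ
  have hMs : ∀ σ ∈ ball (0 : ℂ) ϱ, ‖(fun σ : ℂ => H (γ σ)) σ‖ ≤ M := fun σ hσ => hM _ (hmaps hσ)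
  have h := norm_taylorRem_le (n := n) (differentiableOn_curSlice hH hγ hmaps) hMs h1
  rw [norm_one, one_div] at h
  exact h

omit [CompleteSpace F] in
/-- The ray `σ ↦ σ•A` with `‖A‖ ≤ a`, `0 < a`, maps the disc of radius `R/a` into the ball of radius `R`. [folklore] -/
theorem mapsTo_ray {A : E} {a R : ℝ} (hAa : ‖A‖ ≤ a) (ha : 0 < a) :
    MapsTo (fun σ : ℂ => σ • A) (ball (0:ℂ) (R / a)) (ball (0:E) R) := by
  intro σ hσ
  rw [mem_ball_zero_iff] at hσ ⊢
  rw [norm_smul]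
  calc ‖σ‖ * ‖A‖ ≤ ‖σ‖ * a := mul_le_mul_of_nonneg_left hAa (norm_nonneg σ)
    _ < R / a * a := mul_lt_mul_of_pos_right hσ ha
    _ = R := div_mul_cancel₀ R ha.ne'

omit [CompleteSpace F] in
/-- The ray is entire. [folklore] -/
theorem differentiableOn_ray (A : E) (S : Set ℂ) : DifferentiableOn ℂ (fun σ : ℂ => σ • A) S :=
  (differentiableOn_id.smul_const A)

/-- CONSISTENCY WITH PART 5: along a ray with `‖A‖ ≤ a`, `0 < a < R`, the curve bound with `ϱ = R/a` is exactly
`norm_dirRem_le`'s `2ⁿ·M·(a/R)ⁿ`. [folklore] -/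
example {H : E → F} {R M a : ℝ} {n : ℕ} (hH : DifferentiableOn ℂ H (ball 0 R))
    (hM : ∀ z ∈ ball (0 : E) R, ‖H z‖ ≤ M) {A : E} (hAa : ‖A‖ ≤ a) (ha : 0 < a) (haR : a < R) :
    ‖dirRem H n A‖ ≤ 2 ^ n * M * (a / R) ^ n := by
  have hϱ : 1 < R / a := by rwa [lt_div_iff₀ ha, one_mul]
  have h := norm_curRem_le (n := n) hH hM (differentiableOn_ray A _) (mapsTo_ray hAa ha) hϱ
  rw [curRem_ray, inv_div] at h
  exact h


end Curve

/-! ## §2 The (1.23)-functional of the curve remainder: `B13Sect1Arith.bound_124` with its hypothesis discharged -/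

section Piece

variable {E : Type*} {F : Type*} [NormedAddCommGroup F] [NormedSpace ℂ F] {ι : Type*} [DecidableEq ι]

/-- THE (1.23)-FUNCTIONAL OF THE CURVE REMAINDER: the t_□-circle of radius `r` and the iterated
`∫₀¹ds(Δ)(2πi)⁻¹∮_{|σ(Δ)|=ρ}dσ(Δ)/(σ(Δ)−s(Δ))²` over the cubes `l` (`B13Sect1Arith.cauchyOp`), applied to the order-`n` remainder
of the old term `H` along the slice curve `Γ t s σ : ℂ → E` attached to the contour point (↔ σ′ ↦ U_j(□₀, exp iσ′B(t, s, σ))|_X,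
expansion point σ′ = 0, evaluated at σ′ = 1, analytic on |σ′| < α₃/|B| by [I] Lemma 4 (3.53) with τ = 0, B′ = σ′B; [II]
(1.1)/(1.23).  v1.0.1 DOCFIX: v1 wrote the parametrisation as «exp i(1 + σ′)B» — the remainder `curRem` is centred at 0).
[cite: Balaban1988RG2Cluster, (1.23) p.7] -/
def curPiece (ρ r : ℝ) (l : List ι) (H : E → F) (n : ℕ) (Γ : ℂ → (ι → ℝ) → (ι → ℂ) → ℂ → E)
    (s : ι → ℝ) (σ : ι → ℂ) : F :=
  (2 * Real.pi * I : ℂ)⁻¹ • ∮ t in C(0, r), (t ^ 2)⁻¹ •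
    B13Sect1Arith.cauchyOp ρ l (fun s' σ' => curRem H n (Γ t s' σ')) s σ

/-- The iterated Cauchy operation of (1.23) applied to the zero integrand vanishes (part 2's lemma, re-derived to keep the
import surface minimal). [folklore] -/
theorem cauchyOp_zero' (ρ : ℝ) : ∀ (l : List ι) (s : ι → ℝ) (σ : ι → ℂ),
    B13Sect1Arith.cauchyOp ρ l (fun _ _ => (0 : F)) s σ = 0
  | [], _, _ => rfl
  | i :: l, s, σ => by
    simp only [B13Sect1Arith.cauchyOp, cauchyOp_zero' ρ l, smul_zero, circleIntegral, intervalIntegral.integral_zero]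

/-- The (1.23)-functional of the zero term vanishes. [folklore] -/
theorem curPiece_zero (ρ r : ℝ) (l : List ι) (n : ℕ) (Γ : ℂ → (ι → ℝ) → (ι → ℂ) → ℂ → E) (s : ι → ℝ) (σ : ι → ℂ) :
    curPiece ρ r l (0 : E → F) n Γ s σ = 0 := by
  unfold curPiece
  simp only [curRem_zero, cauchyOp_zero', smul_zero, circleIntegral, intervalIntegral.integral_zero]

variable [NormedAddCommGroup E] [NormedSpace ℂ E]

/-- The ray functional of part 5 is the special case `Γ t s σ = (σ′ ↦ σ′ • A t s σ)` (definitional). [folklore] -/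
theorem curPiece_ray (ρ r : ℝ) (l : List ι) (H : E → F) (n : ℕ) (A : ℂ → (ι → ℝ) → (ι → ℂ) → E) (s : ι → ℝ)
    (σ : ι → ℂ) : curPiece ρ r l H n (fun t s' σ' τ => τ • A t s' σ') s σ = remPiece ρ r l H n A s σ := rfl

variable [CompleteSpace F]

/-- **THE CURVE SPECIES' PER-PIECE BOUND AT FORM LEVEL** ((I.3.54) ⊕ [II] (1.24)): with `ρ = e^{κ₁}`, `κ₁ ≥ 1`, the t_□-radius
`r > 0`, an old term `H` analytic on the ball of radius `R` and bounded by `M` there (↔ (1.18): E₀e^{−κd_j(X)}), and slice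
curves which, at every contour point, are analytic on the disc `|σ′| < ϱ` and map it into that ball (Lemma 4 (3.53)), `ϱ > 1`:
the (1.23)-functional of the order-n curve remainder is bounded by `(1/r)·(2ⁿ·M·ϱ⁻ⁿ)·exp(−(κ₁−1)·#cubes)`.
[cite: Balaban1988RG2Cluster, (1.24) p.7] -/
theorem norm_curPiece_le {κ₁ r R M ϱ : ℝ} {n : ℕ} (hκ : 1 ≤ κ₁) (hr : 0 < r) {H : E → F}
    (hH : DifferentiableOn ℂ H (ball 0 R)) (hM : ∀ z ∈ ball (0 : E) R, ‖H z‖ ≤ M) (hϱ : 1 < ϱ)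
    (l : List ι) (Γ : ℂ → (ι → ℝ) → (ι → ℂ) → ℂ → E)
    (hΓ : ∀ t ∈ Metric.sphere (0:ℂ) r, ∀ s σ,
      (∀ i ∈ l, s i ∈ Set.Icc (0:ℝ) 1 ∧ σ i ∈ Metric.sphere (0:ℂ) (Real.exp κ₁)) →
        DifferentiableOn ℂ (Γ t s σ) (ball 0 ϱ) ∧ MapsTo (Γ t s σ) (ball 0 ϱ) (ball 0 R))
    (s : ι → ℝ) (σ : ι → ℂ) (hsσ : ∀ i ∈ l, s i ∈ Set.Icc (0:ℝ) 1 ∧ σ i ∈ Metric.sphere (0:ℂ) (Real.exp κ₁)) :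
    ‖curPiece (Real.exp κ₁) r l H n Γ s σ‖ ≤ (1 / r) * (2 ^ n * M * ϱ⁻¹ ^ n) * Real.exp (-(κ₁ - 1) * l.length) := by
  -- the remainder bound on the contours
  have hS' : ∀ t ∈ Metric.sphere (0:ℂ) r, ∀ s σ,
      (∀ i ∈ l, s i ∈ Set.Icc (0:ℝ) 1 ∧ σ i ∈ Metric.sphere (0:ℂ) (Real.exp κ₁)) →
        ‖curRem H n (Γ t s σ)‖ ≤ 2 ^ n * M * ϱ⁻¹ ^ n :=
    fun t ht s σ hsσ => norm_curRem_le hH hM (hΓ t ht s σ hsσ).1 (hΓ t ht s σ hsσ).2 hϱ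
  -- nonnegativity of the bound, read off at one admissible contour point (t = r, s ≡ 0, σ ≡ e^{κ₁})
  have hS0 : 0 ≤ 2 ^ n * M * ϱ⁻¹ ^ n := by
    have ht : ((r : ℝ) : ℂ) ∈ Metric.sphere (0:ℂ) r := by simp [abs_of_pos hr]
    have hpar : ∀ i ∈ l, (fun _ : ι => (0:ℝ)) i ∈ Set.Icc (0:ℝ) 1 ∧
        (fun _ : ι => ((Real.exp κ₁ : ℝ) : ℂ)) i ∈ Metric.sphere (0:ℂ) (Real.exp κ₁) := by
      intro i _
      refine ⟨⟨le_rfl, zero_le_one⟩, ?_⟩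
      simp
    exact (norm_nonneg _).trans (hS' _ ht _ _ hpar)
  exact B13Sect1Arith.bound_124 hκ hr hS0 l (fun t s' σ' => curRem H n (Γ t s' σ')) hS' s σ hsσ

end Piece

end Summit.QuantumFields.BalabanUV.T4Continuum.NE9Lemma1CurveRemainder
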